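import Summits.ResolutionOfSingularities.ResolutionOfSingularities.Theorems.FrobeniusLadderFInjectiveMacaulayficationProp44PointStepRT
import Summits.ResolutionOfSingularities.ResolutionOfSingularities.Theorems.FrobeniusLadderFInjectiveMacaulayficationProp44CurveStepRT
import Literature.AlgebraicGeometry.Resolution.CurveGenericChainTermination
import HarnessLib

/-!
# [CoP1] Prop. 4.4, steps 1–3 — a W4.6 sequence reaches a TIDY stage (`stub_reachTidy` of the F-71 skeleton)

[AI: prover `res-inputs-p-5a` (cell res-hironaka; F-71 census row L2 = skeleton v5.2 `stub_reachTidy` :116, binders verbatim, theorem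
`reach_tidy`; design note `plan/inputs/p-5a/L2-REACH-TIDY-DESIGN-p5a-v0.md`). Not a statement of the manuscript under adjudication.
AI-written; AI review is weaker than expert review.]

Cossart–Piltant 2008, proof of Prop. 4.4, p. 10, step 3: «If all components of dimension one of `Σ(i)` are regular and intersect
transversally, and some (distinct) two among them do intersect, let `X(i+1)` be the blowing up of `X(i)` along any such intersecting
curve … we have `n(i+1) ≤ n(i)` whenever `s(i) = 3`. Working above the generic point `η(i)` … `J𝒪_{X(i),η(i)}` principal for `i >> 0`;
hence `n(i)` eventually drops». Here the two counts are merged into one potential: the sum, over the curves of `Σ`, of the colengths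
`λ(𝒪_{X,η}/J_η)` at their generic points, which drops at every blowing up of a curve of `Σ` (`curveStep_potential_lt`: the curves
upstairs inject into the curves downstairs by `η′ ↦ π η′` — Lemma 4.3 (2) (4) via `curveStep_dichotomy` — with
`λ` non-increasing, `IsBlowup.colength_weakTransform_le`, and dropping over the centre, `IsBlowup.colength_weakTransform_lt`).
With Phase I (`exists_seq_regular_transverse`) and the persistence of «no bad point» (`curveStep_noBad`) this gives `reach_tidy`.
[cite: CossartPiltant2008, Prop. 4.4 (proof, p. 10, steps 1–3)]
-/

-- `Summit.<Summit>.<Sub>.Theorems` with `Sub = Summit` (single-conjunct summit, D-0017)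
set_option linter.dupNamespace false

noncomputable section

open CategoryTheory CategoryTheory.Limits AlgebraicGeometry TopologicalSpace IsLocalRing
open Literature.AlgebraicGeometry.Resolution Scheme.IdealSheafData

namespace Summit.ResolutionOfSingularities.ResolutionOfSingularities.Theorems

namespace CP2008Prop44

universe u

/-! ## §1 A finite sum drops along an injection with non-increasing weights and one loss -/

/-- **Counting lemma**: `f` maps `S′` injectively into `S` with `w′ b ≤ w (f b)`; some `a₀ ∈ S` of positive weight either is missed by
`f` or receives a strictly smaller weight. Then `Σ_{S′} w′ < Σ_S w`. [folklore] -/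
theorem sum_lt_sum_of_injOn {α β : Type*} [DecidableEq α] (S' : Finset β) (S : Finset α) (f : β → α)
    (hf : Set.InjOn f S') (hmaps : ∀ b ∈ S', f b ∈ S) (w' : β → ℕ) (w : α → ℕ) (hle : ∀ b ∈ S', w' b ≤ w (f b))
    {a₀ : α} (ha₀ : a₀ ∈ S) (hpos : 0 < w a₀) (hlt : ∀ b ∈ S', f b = a₀ → w' b < w a₀) :
    ∑ b ∈ S', w' b < ∑ a ∈ S, w a := by
  have himg : ∑ b ∈ S', w (f b) = ∑ a ∈ S'.image f, w a :=
    (Finset.sum_image fun x hx y hy h => hf hx hy h).symm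
  have hsub : S'.image f ⊆ S := Finset.image_subset_iff.mpr hmaps
  by_cases h : a₀ ∈ S'.image f
  · obtain ⟨b₀, hb₀, hfb₀⟩ := Finset.mem_image.mp h
    calc ∑ b ∈ S', w' b < ∑ b ∈ S', w (f b) :=
          Finset.sum_lt_sum hle ⟨b₀, hb₀, by rw [hfb₀]; exact hlt b₀ hb₀ hfb₀⟩
      _ = ∑ a ∈ S'.image f, w a := himg
      _ ≤ ∑ a ∈ S, w a := Finset.sum_le_sum_of_subset hsub
  · calc ∑ b ∈ S', w' b ≤ ∑ b ∈ S', w (f b) := Finset.sum_le_sum hle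
      _ = ∑ a ∈ S'.image f, w a := himg
      _ < ∑ a ∈ insert a₀ (S'.image f), w a := by rw [Finset.sum_insert h]; omega
      _ ≤ ∑ a ∈ S, w a := Finset.sum_le_sum_of_subset (Finset.insert_subset ha₀ hsub)

/-! ## §2 The potential drops at a blowing up of a curve of `Σ` -/

/-- In a scheme two points with the same closure are equal. [folklore] -/
theorem eq_of_closure_singleton_eq {X : Scheme.{u}} {a b : X} (h : closure ({a} : Set X) = closure {b}) : a = b :=
  ((specializes_iff_mem_closure.mpr (h ▸ subset_closure (Set.mem_singleton b) : b ∈ closure ({a} : Set X))).antisymm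
    (specializes_iff_mem_closure.mpr (h.symm ▸ subset_closure (Set.mem_singleton a) : a ∈ closure ({b} : Set X)))).eq

/-- **The potential drops** (CP p. 10, «`n(i+1) ≤ n(i)`» and «`J𝒪_{X(i),η(i)}` principal for `i >> 0`; hence `n(i)` eventually drops»,
merged): at a stage without bad points, blowing up a curve `Y` of `Σ` strictly decreases
`Λ = Σ_{η} λ(𝒪_{X,η}/J_η)`, the sum over the generic points of the curves of `Σ` of the colengths.
[cite: CossartPiltant2008, Prop. 4.4 (proof, p. 10, step 3); Lemma 4.3 (2) (4)] [cite: ZariskiSamuel1960, Appendix 5, Thm. 3] -/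
theorem curveStep_potential_lt {X X' : Scheme.{u}} [IsLocallyNoetherian X] [IsLocallyNoetherian X'] (hX : Scheme.IsRegular X)
    (hX3 : topologicalKrullDim X ≤ 3) (J : X.IdealSheafData) {μ : ℕ} (hμ : 1 ≤ μ) (hle : ∀ z, idealOrder J z ≤ μ)
    (hcodim : ∀ z ∈ J.support, 1 < Order.coheight z)
    {𝒞 : Set (Closeds X)} (h𝒞 : ∀ C, C ∈ 𝒞 ↔ ∃ ζ ∈ maxPoints {z : X | (μ : ℕ∞) ≤ idealOrder J z},
      ¬ IsClosed ({ζ} : Set X) ∧ C = ⟨closure {ζ}, isClosed_closure⟩)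
    (hRT : ∀ x : X, ¬ ∃ C ∈ 𝒞,
      x ∈ (vanishingIdeal C).subschemeι '' (Scheme.regularLocus (vanishingIdeal C).subscheme)ᶜ ∨
      (x ∈ (C : Set X) ∧ ∃ C' ∈ 𝒞, C' ≠ C ∧ x ∈ (C' : Set X) ∧
        stalkIdeal (vanishingIdeal C) x ⊔ stalkIdeal (vanishingIdeal C') x ≠ maximalIdeal (X.presheaf.stalk x)))
    {Y : Closeds X} (hY : Y ∈ 𝒞) {π : X' ⟶ X} (hπ : IsBlowup π (vanishingIdeal Y))
    (hle' : ∀ z, idealOrder (controlledTransform π (vanishingIdeal Y) J μ) z ≤ μ)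
    (hfin : {ζ : X | ζ ∈ maxPoints {z : X | (μ : ℕ∞) ≤ idealOrder J z} ∧ ¬ IsClosed ({ζ} : Set X)}.Finite)
    (hfin' : {ζ : X' | ζ ∈ maxPoints {z : X' | (μ : ℕ∞) ≤ idealOrder (controlledTransform π (vanishingIdeal Y) J μ) z} ∧
      ¬ IsClosed ({ζ} : Set X')}.Finite) :
    (∑ᶠ ζ ∈ {ζ : X' | ζ ∈ maxPoints {z : X' | (μ : ℕ∞) ≤ idealOrder (controlledTransform π (vanishingIdeal Y) J μ) z} ∧
        ¬ IsClosed ({ζ} : Set X')},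
      (Module.length (X'.presheaf.stalk ζ)
        (X'.presheaf.stalk ζ ⧸ stalkIdeal (controlledTransform π (vanishingIdeal Y) J μ) ζ)).toNat) <
    ∑ᶠ ζ ∈ {ζ : X | ζ ∈ maxPoints {z : X | (μ : ℕ∞) ≤ idealOrder J z} ∧ ¬ IsClosed ({ζ} : Set X)},
      (Module.length (X.presheaf.stalk ζ) (X.presheaf.stalk ζ ⧸ stalkIdeal J ζ)).toNat := by
  classical
  have hcoh3 : ∀ z : X, Order.coheight z ≤ 3 := (topologicalKrullDim_le_iff_forall_coheight_le X 3).mp hX3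
  rw [finsum_mem_eq_finite_toFinset_sum _ hfin', finsum_mem_eq_finite_toFinset_sum _ hfin]
  -- the centre `Y = cl{ζY}`
  obtain ⟨ζY, hζYmax, hζYcl, rfl⟩ := (h𝒞 Y).mp hY
  obtain ⟨hYreg, hYirr, hYord, hYcurve, -⟩ := curve_of_noBad hX hX3 J hμ hle hcodim h𝒞 hRT hY
  -- facts about the points of `Σ` downstairs
  have hord : ∀ {ζ : X}, ζ ∈ maxPoints {z : X | (μ : ℕ∞) ≤ idealOrder J z} → (μ : ℕ∞) ≤ idealOrder J ζ := fun hζ => by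
    simpa only [Set.mem_setOf_eq] using maxPoints_subset _ hζ
  have hsupp : ∀ {ζ : X}, ζ ∈ maxPoints {z : X | (μ : ℕ∞) ≤ idealOrder J z} → ζ ∈ J.support := fun hζ => by
    rw [← one_le_idealOrder_iff]
    exact le_trans (show (1 : ℕ∞) ≤ (μ : ℕ∞) by exact_mod_cast hμ) (hord hζ)
  have hcoh2 : ∀ {ζ : X}, ζ ∈ maxPoints {z : X | (μ : ℕ∞) ≤ idealOrder J z} → ¬ IsClosed ({ζ} : Set X) →
      Order.coheight ζ = 2 := fun hζ hcl => coheight_eq_two_of_not_isClosed hcoh3 (hcodim _ (hsupp hζ)) hcl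
  have hfinlen : ∀ {ζ : X}, ζ ∈ maxPoints {z : X | (μ : ℕ∞) ≤ idealOrder J z} → ¬ IsClosed ({ζ} : Set X) →
      Module.length (X.presheaf.stalk ζ) (X.presheaf.stalk ζ ⧸ stalkIdeal J ζ) ≠ ⊤ := fun hζ hcl =>
    Module.length_ne_top_iff.mpr (isFiniteLength_quotient_stalkIdeal_of_mem_maxPoints
      (mem_maxPoints_support_of_coheight_eq_two hcodim (hsupp hζ) (hcoh2 hζ hcl)))
  -- over `Y`: the only point of `Σ` specialising from `ζY` on `Y` is `ζY`
  have hgenY : ∀ {ζ : X}, ζ ∈ maxPoints {z : X | (μ : ℕ∞) ≤ idealOrder J z} → ζ ∈ closure ({ζY} : Set X) → ζ = ζY :=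
    fun hζ hmem => ((mem_maxPoints_iff.mp hζ).2 ζY (hord hζYmax) (specializes_iff_mem_closure.mpr hmem)).symm
  -- the one-step colength comparison at a point `η'` of `Σ'` over `ζ ∈ Σ`
  have hstep : ∀ {η' : X'}, η' ∈ maxPoints {z : X' | (μ : ℕ∞) ≤ idealOrder (controlledTransform π (vanishingIdeal
        (⟨closure {ζY}, isClosed_closure⟩ : Closeds X)) J μ) z} →
      π η' ∈ maxPoints {z : X | (μ : ℕ∞) ≤ idealOrder J z} → ¬ IsClosed ({π η'} : Set X) →
      Module.length (X'.presheaf.stalk η') (X'.presheaf.stalk η' ⧸ stalkIdeal (controlledTransform π (vanishingIdeal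
          (⟨closure {ζY}, isClosed_closure⟩ : Closeds X)) J μ) η') ≤
        Module.length (X.presheaf.stalk (π η')) (X.presheaf.stalk (π η') ⧸ stalkIdeal J (π η')) ∧
      (π η' = ζY → Module.length (X'.presheaf.stalk η') (X'.presheaf.stalk η' ⧸ stalkIdeal (controlledTransform π
          (vanishingIdeal (⟨closure {ζY}, isClosed_closure⟩ : Closeds X)) J μ) η') <
        Module.length (X.presheaf.stalk (π η')) (X.presheaf.stalk (π η') ⧸ stalkIdeal J (π η'))) := by
    intro η' hη' hmax hcl
    haveI : IsRegularLocalRing (X.presheaf.stalk (π η')) := hX _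
    have hnear : idealOrder (controlledTransform π (vanishingIdeal (⟨closure {ζY}, isClosed_closure⟩ : Closeds X)) J μ) η' = μ :=
      le_antisymm (hle' η') (by simpa only [Set.mem_setOf_eq] using maxPoints_subset _ hη')
    have hdim2 : (maximalIdeal (X.presheaf.stalk (π η'))).spanFinrank = 2 := spanFinrank_maximalIdeal_stalk_eq (π η') (hcoh2 hmax hcl)
    have hgen : π η' ∈ ((⟨closure {ζY}, isClosed_closure⟩ : Closeds X) : Set X) →
        stalkIdeal (vanishingIdeal (⟨closure {ζY}, isClosed_closure⟩ : Closeds X)) (π η') = maximalIdeal _ := fun hmem => by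
      have heq : π η' = ζY := hgenY hmax hmem
      rw [heq]
      exact stalkIdeal_vanishingIdeal_closure_self ζY
    refine ⟨hπ.colength_weakTransform_le hμ hYord rfl hnear (hX _) hdim2 hgen, fun heq => ?_⟩
    refine hπ.colength_weakTransform_lt hμ hYord rfl hnear (hX _) hdim2 (hgen ?_) ?_
    · rw [heq]; exact subset_closure (Set.mem_singleton ζY)
    · exact Module.length_ne_top_iff.mp (hfinlen hmax hcl)
  -- the dichotomy upstairs, read on generic points (Lemma 4.3 (2) (4) via `curveStep_curves'`)
  have hsuppY : ((vanishingIdeal (⟨closure {ζY}, isClosed_closure⟩ : Closeds X)).support : Set X) = closure {ζY} :=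
    Scheme.IdealSheafData.coe_support_vanishingIdeal _
  have hdich : ∀ {η' : X'}, η' ∈ maxPoints {z : X' | (μ : ℕ∞) ≤ idealOrder (controlledTransform π (vanishingIdeal
        (⟨closure {ζY}, isClosed_closure⟩ : Closeds X)) J μ) z} → ¬ IsClosed ({η'} : Set X') →
      (π η' ∉ closure ({ζY} : Set X) ∧ π η' ∈ maxPoints {z : X | (μ : ℕ∞) ≤ idealOrder J z} ∧ ¬ IsClosed ({π η'} : Set X) ∧
          closure ({η'} : Set X') = closure (π ⁻¹' (closure {π η'} \ closure ({ζY} : Set X)))) ∨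
        (π η' = ζY ∧ ∀ η'' ∈ maxPoints {z : X' | (μ : ℕ∞) ≤ idealOrder (controlledTransform π (vanishingIdeal
            (⟨closure {ζY}, isClosed_closure⟩ : Closeds X)) J μ) z}, ¬ IsClosed ({η''} : Set X') →
            π η'' ∈ closure ({ζY} : Set X) → η'' = η') := by
    intro η' hη' hη'cl
    rcases curveStep_curves' hX hX3 J hμ hle hcodim hYreg hYirr hYord hYcurve hπ hη' hη'cl with
      ⟨hnY, hmax, hcl⟩ | ⟨hclY, -, -, huniq⟩
    · exact Or.inl ⟨hnY, hmax, not_isClosed_singleton_apply hπ hη'cl (by rw [hsuppY]; exact hnY), hcl⟩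
    · exact Or.inr ⟨eq_of_closure_singleton_eq hclY, huniq⟩
  -- apply the counting lemma to `f = π`
  refine sum_lt_sum_of_injOn hfin'.toFinset hfin.toFinset π ?_ ?_ _ _ ?_ (a₀ := ζY) ?_ ?_ ?_
  · -- injective on the generic points upstairs
    intro η₁ hη₁ η₂ hη₂ heq
    rw [Set.Finite.coe_toFinset] at hη₁ hη₂
    rcases hdich hη₁.1 hη₁.2 with ⟨hn₁, -, -, hcl₁⟩ | ⟨hy₁, huniq₁⟩
    · rcases hdich hη₂.1 hη₂.2 with ⟨-, -, -, hcl₂⟩ | ⟨hy₂, -⟩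
      · apply eq_of_closure_singleton_eq
        rw [hcl₁, hcl₂, heq]
      · exact absurd (hy₂ ▸ heq ▸ subset_closure (Set.mem_singleton _) : π η₁ ∈ closure ({ζY} : Set X)) hn₁
    · rcases hdich hη₂.1 hη₂.2 with ⟨hn₂, -, -, -⟩ | ⟨hy₂, -⟩
      · exact absurd (hy₁ ▸ heq.symm ▸ subset_closure (Set.mem_singleton _) : π η₂ ∈ closure ({ζY} : Set X)) hn₂
      · exact (huniq₁ η₂ hη₂.1 hη₂.2 (hy₂ ▸ subset_closure (Set.mem_singleton _))).symm
  · -- lands in the generic points downstairs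
    intro η' hη'
    rw [Set.Finite.mem_toFinset] at hη' ⊢
    rcases hdich hη'.1 hη'.2 with ⟨-, hmax, hcl, -⟩ | ⟨hy, -⟩
    · exact ⟨hmax, hcl⟩
    · rw [hy]; exact ⟨hζYmax, hζYcl⟩
  · -- weights do not increase
    intro η' hη'
    rw [Set.Finite.mem_toFinset] at hη'
    have hdown : π η' ∈ maxPoints {z : X | (μ : ℕ∞) ≤ idealOrder J z} ∧ ¬ IsClosed ({π η'} : Set X) := by
      rcases hdich hη'.1 hη'.2 with ⟨-, hmax, hcl, -⟩ | ⟨hy, -⟩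
      · exact ⟨hmax, hcl⟩
      · rw [hy]; exact ⟨hζYmax, hζYcl⟩
    exact ENat.toNat_le_toNat (hstep hη'.1 hdown.1 hdown.2).1 (hfinlen hdown.1 hdown.2)
  · rw [Set.Finite.mem_toFinset]; exact ⟨hζYmax, hζYcl⟩
  · -- the centre has positive colength
    haveI : IsRegularLocalRing (X.presheaf.stalk ζY) := hX _
    have hne : Module.length (X.presheaf.stalk ζY) (X.presheaf.stalk ζY ⧸ stalkIdeal J ζY) ≠ ⊤ := hfinlen hζYmax hζYcl
    have hposE : 0 < Module.length (X.presheaf.stalk ζY) (X.presheaf.stalk ζY ⧸ stalkIdeal J ζY) := by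
      haveI : Nontrivial (X.presheaf.stalk ζY ⧸ stalkIdeal J ζY) :=
        Ideal.Quotient.nontrivial_iff.mpr (ne_top_of_le_ne_top (Ideal.IsMaximal.ne_top inferInstance)
          ((mem_support_iff_stalkIdeal_le _ _).mp (hsupp hζYmax)))
      exact Module.length_pos
    obtain ⟨k, hk⟩ := ENat.ne_top_iff_exists.mp hne
    rw [← hk] at hposE ⊢
    simp only [ENat.toNat_coe]
    exact_mod_cast hposE
  · -- and the curve over it (if any) has strictly smaller colength
    intro η' hη' heq
    rw [Set.Finite.mem_toFinset] at hη'
    have h := (hstep hη'.1 (heq ▸ hζYmax) (heq ▸ hζYcl)).2 heq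
    rw [heq] at h
    have hne : Module.length (X.presheaf.stalk ζY) (X.presheaf.stalk ζY ⧸ stalkIdeal J ζY) ≠ ⊤ := hfinlen hζYmax hζYcl
    obtain ⟨k, hk⟩ := ENat.ne_top_iff_exists.mp hne
    have hne' : Module.length (X'.presheaf.stalk η') (X'.presheaf.stalk η' ⧸ stalkIdeal (controlledTransform π
        (vanishingIdeal (⟨closure {ζY}, isClosed_closure⟩ : Closeds X)) J μ) η') ≠ ⊤ := ne_top_of_lt h
    obtain ⟨k', hk'⟩ := ENat.ne_top_iff_exists.mp hne'
    rw [← hk, ← hk'] at h ⊢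
    simp only [ENat.toNat_coe]
    exact_mod_cast h

/-! ## §3 Infinite runs with an invariant -/

/-- **Dependent choice along `IsPermissibleBlowupSeq` with an invariant**: if the invariant `I` holds at the start and every reachable
stage satisfying `I` admits one more permissible blowing up with property `P` whose transform again satisfies `I`, then there is an
infinite run all of whose stages satisfy `I` and all of whose steps have `P`. [folklore] -/
theorem exists_chain_of_forall_step_inv {X : Scheme.{u}} (J : X.IdealSheafData) {μ : ℕ}
    (I : ∀ (X₁ : Scheme.{u}), X₁.IdealSheafData → Prop) (P : ∀ (X₁ : Scheme.{u}), X₁.IdealSheafData → Closeds X₁ → Prop)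
    (h₀ : I X J)
    (H : ∀ (X₁ : Scheme.{u}) (Φ : X₁ ⟶ X) (J₁ : X₁.IdealSheafData), CampaignW46.IsPermissibleBlowupSeq J μ Φ J₁ → I X₁ J₁ →
      ∃ (X₂ : Scheme.{u}) (π : X₂ ⟶ X₁) (D : Closeds X₁),
        IsBlowup π (vanishingIdeal D) ∧ Scheme.IsRegular (vanishingIdeal D).subscheme ∧
        (∀ y ∈ (D : Set X₁), (μ : ℕ∞) ≤ idealOrder J₁ y) ∧ P X₁ J₁ D ∧
        I X₂ (controlledTransform π (vanishingIdeal D) J₁ μ)) :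
    ∃ (Xs : ℕ → Scheme.{u}) (π : ∀ n, Xs (n + 1) ⟶ Xs n) (D : ∀ n, Closeds (Xs n))
      (Js : ∀ n, (Xs n).IdealSheafData) (Φ : ∀ n, Xs n ⟶ X),
      (∀ n, IsBlowup (π n) (vanishingIdeal (D n))) ∧
      (∀ n, CampaignW46.IsPermissibleBlowupSeq J μ (Φ n) (Js n)) ∧
      (∀ n, Js (n + 1) = controlledTransform (π n) (vanishingIdeal (D n)) (Js n) μ) ∧
      (∀ n, I (Xs n) (Js n)) ∧ (∀ n, P (Xs n) (Js n) (D n)) := by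
  choose Xn πn Dn hbl hreg hord hP hI using H
  let S : Type (u + 1) := Σ' (X₁ : Scheme.{u}) (Φ : X₁ ⟶ X) (J₁ : X₁.IdealSheafData)
    (_ : CampaignW46.IsPermissibleBlowupSeq J μ Φ J₁), I X₁ J₁
  let next : S → S := fun s =>
    ⟨Xn s.1 s.2.1 s.2.2.1 s.2.2.2.1 s.2.2.2.2, πn s.1 s.2.1 s.2.2.1 s.2.2.2.1 s.2.2.2.2 ≫ s.2.1,
      controlledTransform (πn s.1 s.2.1 s.2.2.1 s.2.2.2.1 s.2.2.2.2)
        (vanishingIdeal (Dn s.1 s.2.1 s.2.2.1 s.2.2.2.1 s.2.2.2.2)) s.2.2.1 μ,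
      CampaignW46.IsPermissibleBlowupSeq.blowup s.2.2.2.1 _ _ (hreg _ _ _ _ _) (hord _ _ _ _ _) (hbl _ _ _ _ _),
      hI _ _ _ _ _⟩
  let s₀ : S := ⟨X, 𝟙 X, J, CampaignW46.IsPermissibleBlowupSeq.nil, h₀⟩
  let ch : ℕ → S := fun n => Nat.rec s₀ (fun _ s => next s) n
  exact ⟨fun n => (ch n).1, fun n => πn (ch n).1 (ch n).2.1 (ch n).2.2.1 (ch n).2.2.2.1 (ch n).2.2.2.2,
    fun n => Dn (ch n).1 (ch n).2.1 (ch n).2.2.1 (ch n).2.2.2.1 (ch n).2.2.2.2,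
    fun n => (ch n).2.2.1, fun n => (ch n).2.1, fun n => hbl _ _ _ _ _, fun n => (ch n).2.2.2.1, fun n => rfl,
    fun n => (ch n).2.2.2.2, fun n => hP _ _ _ _ _⟩

/-! ## §4 Phase II: from «no bad point» to a TIDY stage -/

/-- A point of `Σ = {ord ≥ μ}` of codimension `2` is a maximal point of `Σ` (its proper generisations have codimension `≤ 1` and
lie in `V(J)`, of codimension `≥ 2`). [folklore] -/
theorem mem_maxPoints_setOf_of_coheight_eq_two {X : Scheme.{u}} {J : X.IdealSheafData} {μ : ℕ} (hμ : 1 ≤ μ)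
    (hcoh3 : ∀ z : X, Order.coheight z ≤ 3) (hcodim : ∀ z ∈ J.support, 1 < Order.coheight z)
    {ζ : X} (hζ : (μ : ℕ∞) ≤ idealOrder J ζ) (hcoh : Order.coheight ζ = 2) :
    ζ ∈ maxPoints {z : X | (μ : ℕ∞) ≤ idealOrder J z} := by
  refine mem_maxPoints_iff.mpr ⟨hζ, fun z hz hsp => ?_⟩
  have hzsupp : z ∈ J.support := by
    rw [← one_le_idealOrder_iff]
    exact le_trans (show (1 : ℕ∞) ≤ (μ : ℕ∞) by exact_mod_cast hμ) hz
  by_contra hne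
  have hnsp : ¬ ζ ⤳ z := fun h => hne (h.antisymm hsp).eq.symm
  have h := (coheight_eq_two_of_specializes hsp hnsp (hcodim z hzsupp) (hcoh3 ζ)).2
  rw [hcoh] at h
  exact absurd h (by decide)

/-- **Phase II of the algorithm (step 3 terminates).** From an integral Noetherian regular quasi-excellent stage of dimension `≤ 3`
with `(J, μ)` (`ord ≤ μ`, `codim V(J) ≥ 2`) and NO bad point, a W4.6 sequence of permissible blowing-ups (of curves of `Σ`) reaches a
TIDY stage: the curves of `Σ` are regular and pairwise disjoint. [cite: CossartPiltant2008, Prop. 4.4 (proof, p. 10, step 3)] -/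
theorem reach_tidy_of_noBad {X : Scheme.{u}} [IsIntegral X] [IsNoetherian X] (hX : Scheme.IsRegular X)
    (hqe : Scheme.IsQuasiExcellent X) (hX3 : topologicalKrullDim X ≤ 3) (J : X.IdealSheafData) {μ : ℕ} (hμ : 1 ≤ μ)
    (hle : ∀ z, idealOrder J z ≤ μ) (hcodim : ∀ z ∈ J.support, 1 < Order.coheight z)
    (hRT : ∀ x : X, ¬ ∃ C ∈ {C : Closeds X | ∃ ζ ∈ maxPoints {z : X | (μ : ℕ∞) ≤ idealOrder J z},
        ¬ IsClosed ({ζ} : Set X) ∧ C = ⟨closure {ζ}, isClosed_closure⟩},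
      x ∈ (vanishingIdeal C).subschemeι '' (Scheme.regularLocus (vanishingIdeal C).subscheme)ᶜ ∨
      (x ∈ (C : Set X) ∧ ∃ C' ∈ {C : Closeds X | ∃ ζ ∈ maxPoints {z : X | (μ : ℕ∞) ≤ idealOrder J z},
          ¬ IsClosed ({ζ} : Set X) ∧ C = ⟨closure {ζ}, isClosed_closure⟩}, C' ≠ C ∧ x ∈ (C' : Set X) ∧
        stalkIdeal (vanishingIdeal C) x ⊔ stalkIdeal (vanishingIdeal C') x ≠ maximalIdeal (X.presheaf.stalk x))) :
    ∃ (X₁ : Scheme.{u}) (Φ : X₁ ⟶ X) (J₁ : X₁.IdealSheafData) (_ : CampaignW46.IsPermissibleBlowupSeq J μ Φ J₁),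
      (∀ ζ : X₁, (μ : ℕ∞) ≤ idealOrder J₁ ζ → Order.coheight ζ = 2 → ¬ IsClosed ({ζ} : Set X₁) →
          Scheme.IsRegular (vanishingIdeal (⟨closure {ζ}, isClosed_closure⟩ : Closeds X₁)).subscheme) ∧
      (∀ ζ₁ ζ₂ : X₁, (μ : ℕ∞) ≤ idealOrder J₁ ζ₁ → Order.coheight ζ₁ = 2 → ¬ IsClosed ({ζ₁} : Set X₁) →
          (μ : ℕ∞) ≤ idealOrder J₁ ζ₂ → Order.coheight ζ₂ = 2 → ¬ IsClosed ({ζ₂} : Set X₁) → ζ₁ ≠ ζ₂ →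
          Disjoint (closure ({ζ₁} : Set X₁)) (closure {ζ₂})) := by
  classical
  by_contra Hc
  have inv := fun {X₁ : Scheme.{u}} {Φ : X₁ ⟶ X} {J₁ : X₁.IdealSheafData}
      (h : CampaignW46.IsPermissibleBlowupSeq J μ Φ J₁) => IsPermissibleBlowupSeq.prop44Invariants hX hqe hμ hle hcodim h
  -- invariant «no bad point», step property «the centre is a curve of Σ»
  let I : ∀ (X₁ : Scheme.{u}), X₁.IdealSheafData → Prop := fun X₁ J₁ =>
    ∀ x : X₁, ¬ ∃ C ∈ {C : Closeds X₁ | ∃ ζ ∈ maxPoints {z : X₁ | (μ : ℕ∞) ≤ idealOrder J₁ z},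
        ¬ IsClosed ({ζ} : Set X₁) ∧ C = ⟨closure {ζ}, isClosed_closure⟩},
      x ∈ (vanishingIdeal C).subschemeι '' (Scheme.regularLocus (vanishingIdeal C).subscheme)ᶜ ∨
      (x ∈ (C : Set X₁) ∧ ∃ C' ∈ {C : Closeds X₁ | ∃ ζ ∈ maxPoints {z : X₁ | (μ : ℕ∞) ≤ idealOrder J₁ z},
          ¬ IsClosed ({ζ} : Set X₁) ∧ C = ⟨closure {ζ}, isClosed_closure⟩}, C' ≠ C ∧ x ∈ (C' : Set X₁) ∧
        stalkIdeal (vanishingIdeal C) x ⊔ stalkIdeal (vanishingIdeal C') x ≠ maximalIdeal (X₁.presheaf.stalk x))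
  let P : ∀ (X₁ : Scheme.{u}), X₁.IdealSheafData → Closeds X₁ → Prop := fun X₁ J₁ D =>
    D ∈ {C : Closeds X₁ | ∃ ζ ∈ maxPoints {z : X₁ | (μ : ℕ∞) ≤ idealOrder J₁ z},
        ¬ IsClosed ({ζ} : Set X₁) ∧ C = ⟨closure {ζ}, isClosed_closure⟩}
  have H : ∀ (X₁ : Scheme.{u}) (Φ : X₁ ⟶ X) (J₁ : X₁.IdealSheafData), CampaignW46.IsPermissibleBlowupSeq J μ Φ J₁ → I X₁ J₁ →
      ∃ (X₂ : Scheme.{u}) (π : X₂ ⟶ X₁) (D : Closeds X₁),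
        IsBlowup π (vanishingIdeal D) ∧ Scheme.IsRegular (vanishingIdeal D).subscheme ∧
        (∀ y ∈ (D : Set X₁), (μ : ℕ∞) ≤ idealOrder J₁ y) ∧ P X₁ J₁ D ∧
        I X₂ (controlledTransform π (vanishingIdeal D) J₁ μ) := by
    intro X₁ Φ J₁ hseq hI
    obtain ⟨hint₁, hnoeth₁, hX₁, hqe₁, hle₁, hcodim₁⟩ := inv hseq
    haveI := hint₁
    haveI := hnoeth₁
    have hX3₁ : topologicalKrullDim X₁ ≤ 3 := hseq.topologicalKrullDim_le inferInstance hX3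
    have hcoh3 : ∀ z : X₁, Order.coheight z ≤ 3 := (topologicalKrullDim_le_iff_forall_coheight_le X₁ 3).mp hX3₁
    -- the stage is not TIDY, but its curves are regular: two distinct curves of `Σ₁` meet
    have hREG : ∀ ζ : X₁, (μ : ℕ∞) ≤ idealOrder J₁ ζ → Order.coheight ζ = 2 → ¬ IsClosed ({ζ} : Set X₁) →
        Scheme.IsRegular (vanishingIdeal (⟨closure {ζ}, isClosed_closure⟩ : Closeds X₁)).subscheme :=
      fun ζ hζ hcoh hcl => (curve_of_noBad hX₁ hX3₁ J₁ hμ hle₁ hcodim₁ (𝒞 := {C : Closeds X₁ | _}) (fun C => Iff.rfl) hI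
        ⟨ζ, mem_maxPoints_setOf_of_coheight_eq_two hμ hcoh3 hcodim₁ hζ hcoh, hcl, rfl⟩).1
    have hex : ∃ ζ₁ : X₁, (μ : ℕ∞) ≤ idealOrder J₁ ζ₁ ∧ Order.coheight ζ₁ = 2 ∧ ¬ IsClosed ({ζ₁} : Set X₁) := by
      by_contra hnone
      push Not at hnone
      exact Hc ⟨X₁, Φ, J₁, hseq, hREG, fun ζ₁ ζ₂ h1 h2 h3 _ _ _ _ => (h3 (hnone ζ₁ h1 h2)).elim⟩
    obtain ⟨ζ₁, hζ₁ord, hζ₁coh, hζ₁cl⟩ := hex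
    have hY : (⟨closure {ζ₁}, isClosed_closure⟩ : Closeds X₁) ∈ {C : Closeds X₁ | ∃ ζ ∈ maxPoints
        {z : X₁ | (μ : ℕ∞) ≤ idealOrder J₁ z}, ¬ IsClosed ({ζ} : Set X₁) ∧ C = ⟨closure {ζ}, isClosed_closure⟩} :=
      ⟨ζ₁, mem_maxPoints_setOf_of_coheight_eq_two hμ hcoh3 hcodim₁ hζ₁ord hζ₁coh, hζ₁cl, rfl⟩
    obtain ⟨hYreg, -, hYord, -, -⟩ := curve_of_noBad hX₁ hX3₁ J₁ hμ hle₁ hcodim₁ (𝒞 := {C : Closeds X₁ | _})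
      (fun C => Iff.rfl) hI hY
    obtain ⟨X₂, π, hπ⟩ := exists_isBlowup X₁ (vanishingIdeal (⟨closure {ζ₁}, isClosed_closure⟩ : Closeds X₁))
    haveI : IsLocallyNoetherian X₂ := hπ.isLocallyNoetherian
    exact ⟨X₂, π, _, hπ, hYreg, fun y hy => (hYord y hy).ge, hY,
      curveStep_noBad hX₁ hX3₁ J₁ hμ hle₁ hcodim₁ (𝒞 := {C : Closeds X₁ | _}) (fun C => Iff.rfl) hI hY hπ
        (𝒞' := {C : Closeds X₂ | _}) (fun C' => Iff.rfl)⟩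
  obtain ⟨Xs, π, D, Js, Φ, hπ, hseq, hJ, hI, hP⟩ := exists_chain_of_forall_step_inv J I P hRT H
  -- stage invariants
  have hnoeth : ∀ n, IsNoetherian (Xs n) := fun n => (inv (hseq n)).2.1
  haveI : ∀ n, IsLocallyNoetherian (Xs n) := fun n => inferInstance
  have hint : ∀ n, IsIntegral (Xs n) := fun n => (inv (hseq n)).1
  have hreg : ∀ n, Scheme.IsRegular (Xs n) := fun n => (inv (hseq n)).2.2.1
  have hqe' : ∀ n, Scheme.IsQuasiExcellent (Xs n) := fun n => (inv (hseq n)).2.2.2.1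
  have hle' : ∀ n, ∀ z, idealOrder (Js n) z ≤ μ := fun n => (inv (hseq n)).2.2.2.2.1
  have hcodim' : ∀ n, ∀ z ∈ (Js n).support, 1 < Order.coheight z := fun n => (inv (hseq n)).2.2.2.2.2
  have hX3' : ∀ n, topologicalKrullDim (Xs n) ≤ 3 := fun n => (hseq n).topologicalKrullDim_le inferInstance hX3
  have hfin : ∀ n, {ζ : Xs n | ζ ∈ maxPoints {z : Xs n | (μ : ℕ∞) ≤ idealOrder (Js n) z} ∧ ¬ IsClosed ({ζ} : Set (Xs n))}.Finite :=
    fun n => by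
      haveI := hint n
      have hJne : Js n ≠ ⊥ := ne_bot_of_forall_one_lt_coheight (hcodim' n)
      have hcl : IsClosed {z : Xs n | (μ : ℕ∞) ≤ idealOrder (Js n) z} :=
        isClosed_setOf_le_idealOrder_of_isJ2 (hreg n) (fun U => ((hqe' n) U).isJ2Ring) hJne μ
      exact (maxPoints_finite hcl).subset fun ζ hζ => hζ.1
  -- the potential and its strict decrease
  let Λ : ℕ → ℕ := fun n => ∑ᶠ ζ ∈ {ζ : Xs n | ζ ∈ maxPoints {z : Xs n | (μ : ℕ∞) ≤ idealOrder (Js n) z} ∧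
      ¬ IsClosed ({ζ} : Set (Xs n))}, (Module.length ((Xs n).presheaf.stalk ζ) ((Xs n).presheaf.stalk ζ ⧸ stalkIdeal (Js n) ζ)).toNat
  have hlt : ∀ n, Λ (n + 1) < Λ n := by
    intro n
    have hfin1 := hfin (n + 1)
    have hle1 := hle' (n + 1)
    change (∑ᶠ ζ ∈ {ζ : Xs (n + 1) | ζ ∈ maxPoints {z : Xs (n + 1) | (μ : ℕ∞) ≤ idealOrder (Js (n + 1)) z} ∧
        ¬ IsClosed ({ζ} : Set (Xs (n + 1)))}, (Module.length ((Xs (n + 1)).presheaf.stalk ζ)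
          ((Xs (n + 1)).presheaf.stalk ζ ⧸ stalkIdeal (Js (n + 1)) ζ)).toNat) < _
    rw [hJ n] at hfin1 hle1 ⊢
    exact curveStep_potential_lt (hreg n) (hX3' n) (Js n) hμ (hle' n) (hcodim' n) (𝒞 := {C : Closeds (Xs n) | _})
      (fun C => Iff.rfl) (hI n) (hP n) (hπ n) hle1 (hfin n) hfin1
  have hmono : ∀ n, Λ n + n ≤ Λ 0 := by
    intro n
    induction n with
    | zero => simp
    | succ n ih => have := hlt n; omega
  have := hmono (Λ 0 + 1)
  omega

/-! ## §5 `stub_reachTidy` -/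

/-- **REACH A TIDY STAGE** (Cossart–Piltant 2008, Prop. 4.4, proof, steps 1–3) — the statement `stub_reachTidy` of the F-71 assembly
skeleton (cell res-hironaka, v5.2), binders VERBATIM: from an integral Noetherian regular quasi-excellent `X` of dimension `≤ 3`
with `(J, μ)`, `μ ≥ 1`, `ord ≤ μ`, `codim V(J) ≥ 2`, a W4.6 sequence of permissible blowing-ups reaches a stage whose order-`μ`
curves (closures of the order-`μ` points of codimension `2` that are not closed points) are regular and pairwise disjoint. Phase I
(`exists_seq_regular_transverse`, steps 1–2) followed by Phase II (`reach_tidy_of_noBad`, step 3).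
[cite: CossartPiltant2008, Prop. 4.4 (proof, pp. 9–10, steps 1–3, (*))] -/
theorem reach_tidy {X : Scheme.{u}} [IsIntegral X] [IsNoetherian X] (hX : Scheme.IsRegular X) (hqe : Scheme.IsQuasiExcellent X)
    (hX3 : topologicalKrullDim X ≤ 3) (J : X.IdealSheafData) {μ : ℕ} (hμ : 1 ≤ μ) (hle : ∀ z, idealOrder J z ≤ μ)
    (hcodim : ∀ z ∈ J.support, 1 < Order.coheight z) :
    ∃ (X₁ : Scheme.{u}) (Φ : X₁ ⟶ X) (J₁ : X₁.IdealSheafData) (_ : CampaignW46.IsPermissibleBlowupSeq J μ Φ J₁),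
      (∀ ζ : X₁, (μ : ℕ∞) ≤ idealOrder J₁ ζ → Order.coheight ζ = 2 → ¬ IsClosed ({ζ} : Set X₁) →
          Scheme.IsRegular (vanishingIdeal (⟨closure {ζ}, isClosed_closure⟩ : Closeds X₁)).subscheme) ∧
      (∀ ζ₁ ζ₂ : X₁, (μ : ℕ∞) ≤ idealOrder J₁ ζ₁ → Order.coheight ζ₁ = 2 → ¬ IsClosed ({ζ₁} : Set X₁) →
          (μ : ℕ∞) ≤ idealOrder J₁ ζ₂ → Order.coheight ζ₂ = 2 → ¬ IsClosed ({ζ₂} : Set X₁) → ζ₁ ≠ ζ₂ →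
          Disjoint (closure ({ζ₁} : Set X₁)) (closure {ζ₂})) := by
  obtain ⟨X₁, Φ₁, J₁, hseq₁, hRT₁⟩ := exists_seq_regular_transverse hX hqe hX3 J hμ hle hcodim
  obtain ⟨hint₁, hnoeth₁, hX₁, hqe₁, hle₁, hcodim₁⟩ := IsPermissibleBlowupSeq.prop44Invariants hX hqe hμ hle hcodim hseq₁
  haveI := hint₁
  haveI := hnoeth₁
  have hX3₁ : topologicalKrullDim X₁ ≤ 3 := hseq₁.topologicalKrullDim_le inferInstance hX3
  obtain ⟨X₂, Φ₂, J₂, hseq₂, htidy⟩ := reach_tidy_of_noBad hX₁ hqe₁ hX3₁ J₁ hμ hle₁ hcodim₁ hRT₁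
  exact ⟨X₂, Φ₂ ≫ Φ₁, J₂, hseq₁.comp hseq₂, htidy⟩

end CP2008Prop44

end Summit.ResolutionOfSingularities.ResolutionOfSingularities.Theorems

end
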